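import Literature.AnabelianGeometry.EtaleTheta.Discharge.Sec4Prop42SubHullClauses
import HarnessLib

/-!
# [EtTh] Prop. 4.2 (iii)/(iv): the roots-of-constants law AT AN ARBITRARY DOMAIN `A` on whose base `H_⊙` acts
# trivially — the `constantRootsAt` shape (binder `hL_A` of `unitRootsUpstairsAt_of_constantRootsAt`, `h₅` of
# abc-iut-L2-t4's `Prop42_iv_iso`, G-w4d044-1-at-`A_1` of [EtTh] Thm. 5.7's `_final_v3/_v4`) DISCHARGED over
# `B^temp(Π^tp_X)⁰` and at the faithful [FrdII] Def. 2.2 (ii) slot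

S. Mochizuki, *The étale theta function and its Frobenioid-theoretic manifestations*, Publ. RIMS **45** (2009)
[MochizukiEtTh2009], §4, Prop. 4.2 (iii)/(iv), PDF p.90 L14–17 («it follows from the "`(N, H_⊙, f|_{A_N})`-saturated-ness"
condition … that the pull-back … of any element `∈ O^×(A_⊙)` … admits an `N`-th root»); Def. 4.1 p.86 («`H_⊙ ⊆ Π^tp_X` the
open subgroup determined by `A_⊙^bs`», (ii) «`H_A^bs ⊆ Aut_D(A^bs)` the image of `H_⊙`»).  S. Mochizuki, *The geometry of
Frobenioids II* [MochizukiFrdII2008], Rmk. 2.2.1 p.18.  [cite: MochizukiEtTh2009, Prop 4.2 p.90] [cite: MochizukiFrdII2008, Rmk 2.2.1 p.18]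

abc-iut cell, layer L2, DAG nodes `EtTh:Prop4.2(iii)` / `EtTh:Prop4.2(iv)` (and the [EtTh] Thm. 5.7 consumer row
G-f123-1 «REDUCED-TO G-w4d044-1-at-A_1», abc-iut-L2-lead R596/R647; abc-iut-f-123 g6 21:23:41Z «WANT At-variant at
A := (R 1).AN … (H_⊙ acts over A_1^bs via α^bs)»); seat abc-iut-w4-d044 (gen 5).  PROOF-ONLY (0 `def`s; nothing landed is
edited or restated).  `Sec4Prop42SubHullClauses.lean` (this lineage, p466882) proved the roots-of-constants law `hL` for the
constants of `A_⊙` itself.  The SAME proof gives the law for the constants of ANY object `A` whose base `A^bs` is Galois and on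
which `H_⊙` acts TRIVIALLY (`htriv : ∀ g̃ ∈ H_⊙, galoisSurj_{A^bs} g̃ = 1`, i.e. `H_A^bs = {1}` in the notation of Def. 4.1 (ii)
— e.g. `A = A_⊙`, or `A^bs ≅ A_⊙^bs` over `Π^tp_X`, or `A^bs` a quotient of `A_⊙^bs`): the deck transformations named by `H_⊙`
on any Galois `A″^bs ⟶ A^bs` then lie OVER `A^bs` (`galoisSurj_hom_comp_eq_of_hodot_trivial`, Def. 4.1 (ii) naturality +
normality of `H_⊙`), so a unit of `A″` carrying a pulled-back constant of `A` is fixed by their lifts and acquires its `N`-th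
root from [FrdII] Rmk. 2.2.1 exactly as before:
* `Prop42Sub.constantRootsAt_mkOfConnectedTemperoid_of_invariantUnitRoots` (any slot `NH`): `hL_A` ⟸ `hroot_A` («`N`-th roots
  of `H_⊙`-invariant units of the Frobenius-trivial `NH`-saturated `A″` over `A`»);
* `Prop42Sub.invariantUnitRootsAt_of_def22Ctx`: `hroot_A` ⟸ `PadicKummer.SaturatedInvariantsAdmitRoots (def22Ctx A″) N` for
  the Frobenius-trivial `A″` over `A` (BY NAME) + the B2 context law `hact`;
* `Prop42Sub.constantRootsAt_mkOfConnectedTemperoid_faithful`: at the FAITHFUL slot (NH := «`def22Ctx A` is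
  `(N, H)`-saturated», reading `Iff.rfl`) **`hL_A` ⟸ {`Φ` divisorial} ∪ {B2 data `haug`/`act`/`hact`} ∪ {[FrdII] Rmk. 2.2.1 at
  the instance BY NAME (`h221_A`)} ∪ {`htriv`}** — the shape consumed verbatim by `Prop42Sub.unitRootsUpstairsAt_of_constantRootsAt`
  (p457540) and by abc-iut-f-123's `hsurj_of_constantRootsAt_family` (p462665) at `A := A_1`.
HONEST LABEL: print takes the constants of `A_⊙` (p.90 L16); for a domain `A` with `H_A^bs ≠ {1}` the law is NOT claimed
here (a constant of such an `A` need not be `H_⊙`-invariant upstairs) — `htriv` is the exact scope.  HONEST FRAMING: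
[EtTh]/[FrdII] are refereed prerequisite papers; typed ≠ proved for the binders; nothing here bears on, or takes a side on,
the disputed [IUTchIII] Cor. 3.12; nothing here asserts abc proved or refuted.
-/

noncomputable section

namespace Literature.AnabelianGeometry.EtaleTheta

open CategoryTheory Opposite Literature.AlgebraicGeometry.Frobenioids Literature.AnabelianGeometry.SemiGraphs
  Literature.AlgebraicGeometry.Frobenioids.QuasiTemperoid.BTempConnected

namespace BiKummerSetting

universe u₀ v₀ w

/-! ## §1 Over `B^temp(Π^tp_X)⁰`, any saturation slot `NH` -/

section Connected

variable {K : Type u₀} [Field K] (X : SemiGraphs.TemperedArithmeticGroup.{u₀} K) {D₀ : Type u₀} [Category.{v₀} D₀]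
  {V : FrdIMonoidStub.{w}} {T₀ : RealifiedDivisorMonoids (D₀ := D₀) V}
  {VD : FrdICatStub.{u₀ + 1, u₀, w} (ConnectedPart (BTemp X.Pi))}
  (tf : TemperedFrobenioid T₀ (ConnectedPart (BTemp X.Pi)) VD) (hZ : tf.monoidType = MonoidType.Z)
  (hP : ∀ A : (ConnectedPart (BTemp X.Pi))ᵒᵖ, IsPerfect (tf.Φ.carrier A))
  (NH : Subgroup (Field.absoluteGaloisGroup K) → tf.category → ℕ+ → Prop)
  (A₀ : tf.category) (hA₀ : PreFrobenioid.IsFrobeniusTrivial tf.toElem A₀) (hA₀' : SemiGraphs.IsGaloisObj A₀.base.obj)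

/-- **`H_⊙` acts by deck transformations OVER every Galois base on which it acts trivially** (Def. 4.1 (ii): `H_A^bs` = the
image of `H_⊙` in `Aut_D(A^bs)`; here `H_A^bs = {1}`): for Galois `A'`, `A` with `galoisSurj_A(H_⊙) = 1`, every `b : A' ⟶ A` and
`g ∈ H_⊙`, the deck transformation of `A'` named by `g` lies over `b` (naturality of the Galois surjections, a theorem over
`B^temp(Π^tp_X)⁰`, + normality of `H_⊙`). [cite: MochizukiEtTh2009, Def 4.1 p.87] -/
theorem galoisSurj_hom_comp_eq_of_hodot_trivial {A' A : ConnectedPart (BTemp X.Pi)} (hA' : SemiGraphs.IsGaloisObj A'.obj)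
    (hA : SemiGraphs.IsGaloisObj A.obj)
    (htriv : ∀ g ∈ (mkOfConnectedTemperoid X tf hZ hP NH A₀ hA₀ hA₀').Hodot,
      (mkOfConnectedTemperoid X tf hZ hP NH A₀ hA₀ hA₀').galoisSurj A hA g = 1)
    (b : A' ⟶ A) {g : X.Pi} (hg : g ∈ (mkOfConnectedTemperoid X tf hZ hP NH A₀ hA₀ hA₀').Hodot) :
    ((mkOfConnectedTemperoid X tf hZ hP NH A₀ hA₀ hA₀').galoisSurj A' hA' g).hom ≫ b = b := by
  obtain ⟨c, hc⟩ := mkOfConnectedTemperoid_galoisSurj_natural X tf hZ hP NH A₀ hA₀ hA₀' hA hA' b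
  haveI := (mkOfConnectedTemperoid X tf hZ hP NH A₀ hA₀ hA₀').hodot_normal
  rw [hc g, htriv _ ((inferInstance : (mkOfConnectedTemperoid X tf hZ hP NH A₀ hA₀ hA₀').Hodot.Normal).conj_mem g hg c)]
  exact Category.comp_id b

/-- At `A := A_⊙` the triviality hypothesis holds: `H_⊙ = Ker(Π^tp_X ↠ Aut(A_⊙^bs))`. [cite: MochizukiEtTh2009, Def 4.1 p.86] -/
theorem hodot_trivial_Aodot :
    ∀ g ∈ (mkOfConnectedTemperoid X tf hZ hP NH A₀ hA₀ hA₀').Hodot,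
      (mkOfConnectedTemperoid X tf hZ hP NH A₀ hA₀ hA₀').galoisSurj A₀.base hA₀' g = 1 :=
  fun _ hg => hg

/-- **The roots-of-constants law AT A DOMAIN `A` with `H_A^bs = {1}`, from `N`-th roots of `H_⊙`-invariant units** (any slot
`NH`): if every unit of a Frobenius-trivial `NH`-saturated `A″` over `A` that is fixed under conjugation by all lifts of
`H_⊙`-deck transformations has an `N`-th root in `O^×(A″)` (`hroot`), then the pull-back to `A″` of every `Div_B`-trivial
`ξ ∈ B(A^bs)` has an `N`-th root in `B(A″^bs)` — the proof of `constantRoots_mkOfConnectedTemperoid_of_invariantUnitRoots`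
(p466882) with `A_⊙` replaced by `A` and the decks lying over `A^bs` by `htriv`. [cite: MochizukiEtTh2009, Prop 4.2 p.90] -/
theorem Prop42Sub.constantRootsAt_mkOfConnectedTemperoid_of_invariantUnitRoots
    (hΦd : Objectwise (fun M _ => IsDivisorial M) tf.divisorMonoid)
    (A : tf.category) (hA : SemiGraphs.IsGaloisObj A.base.obj)
    (htriv : ∀ g ∈ (mkOfConnectedTemperoid X tf hZ hP NH A₀ hA₀ hA₀').Hodot,
      (mkOfConnectedTemperoid X tf hZ hP NH A₀ hA₀ hA₀').galoisSurj A.base hA g = 1)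
    (hroot : ∀ (A'' : tf.category) (N : ℕ+), (A''.base ⟶ A.base) →
      PreFrobenioid.IsFrobeniusTrivial tf.toElem A'' →
      NH (mkOfConnectedTemperoid X tf hZ hP NH A₀ hA₀ hA₀').HodotBsFld A'' N →
      ∀ u : Aut A'', u ∈ tf.units A'' →
        (∀ (hA'' : SemiGraphs.IsGaloisObj A''.base.obj) (g : X.Pi),
          g ∈ (mkOfConnectedTemperoid X tf hZ hP NH A₀ hA₀ hA₀').Hodot →
          ∀ α : Aut A'', ModelFrobenioid.baseMap α.hom =
            ((mkOfConnectedTemperoid X tf hZ hP NH A₀ hA₀ hA₀').galoisSurj A''.base hA'' g).hom →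
            α * u * α⁻¹ = u) →
        ∃ r : Aut A'', r ∈ tf.units A'' ∧ r ^ (N : ℕ) = u) :
    ∀ (A'' : tf.category) (N : ℕ+) (g : A''.base ⟶ A.base) (ξ : tf.ratFnFunctor.obj (op A.base)),
      PreFrobenioid.IsFrobeniusTrivial tf.toElem A'' →
      NH (mkOfConnectedTemperoid X tf hZ hP NH A₀ hA₀ hA₀').HodotBsFld A'' N →
      divB tf.divisorMonoid tf.ratFnFunctor tf.divBNatTrans (op A.base) ξ = 1 →
        ∃ ζ : tf.ratFnFunctor.obj (op A''.base), ζ ^ (N : ℕ) = pull tf.ratFnFunctor g ξ := by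
  intro A'' N g ξ hft hsat hξ
  have hw : divB tf.divisorMonoid tf.ratFnFunctor tf.divBNatTrans (op A''.base) (pull tf.ratFnFunctor g ξ) = 1 :=
    ModelFrobenioid.divB_pull_eq_one_of_divB_eq_one g ξ hξ
  obtain ⟨u, hu, huw⟩ := ModelFrobenioid.exists_mem_units_unit_eq A'' (tf.ratFnFunctor_isGroupLike_holds A''.base)
    (pull tf.ratFnFunctor g ξ) hw
  have hinv : ∀ (hA'' : SemiGraphs.IsGaloisObj A''.base.obj) (g' : X.Pi),
      g' ∈ (mkOfConnectedTemperoid X tf hZ hP NH A₀ hA₀ hA₀').Hodot →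
      ∀ α : Aut A'', ModelFrobenioid.baseMap α.hom =
        ((mkOfConnectedTemperoid X tf hZ hP NH A₀ hA₀ hA₀').galoisSurj A''.base hA'' g').hom → α * u * α⁻¹ = u := by
    intro hA'' g' hg' α hα
    apply ModelFrobenioid.conj_eq_self_of_pull_unit_eq (hΦd A''.base).isSharp hu α
    have h1 : ModelFrobenioid.baseMap α.hom ≫ g = g := by
      rw [hα]
      exact galoisSurj_hom_comp_eq_of_hodot_trivial X tf hZ hP NH A₀ hA₀ hA₀' hA'' hA htriv g hg'
    have h2 : ModelFrobenioid.baseMap α.inv ≫ g = g := by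
      calc ModelFrobenioid.baseMap α.inv ≫ g
          = ModelFrobenioid.baseMap α.inv ≫ ModelFrobenioid.baseMap α.hom ≫ g := by rw [h1]
        _ = g := by rw [← Category.assoc, ModelFrobenioid.baseMap_inv_comp_hom, Category.id_comp]
    rw [huw, ← pull_comp, h2]
  obtain ⟨r, hr, hrN⟩ := hroot A'' N g hft hsat u ⟨hu.1, hu.2⟩ hinv
  refine ⟨ModelFrobenioid.unit r.hom, ?_⟩
  rw [← ModelFrobenioid.unit_pow_hom_of_mem_units ⟨hr.1, hr.2⟩, hrN, huw]

end Connected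

/-! ## §2 At the B2 datum `def22Ctx`, faithful slot -/

section Faithful

variable {K : Type} [Field K] (X : SemiGraphs.TemperedArithmeticGroup.{0} K) {D₀ : Type} [Category.{0} D₀]
  {V : FrdIMonoidStub.{0}} {T₀ : RealifiedDivisorMonoids (D₀ := D₀) V}
  {VD : FrdICatStub.{1, 0, 0} (ConnectedPart (BTemp X.Pi))}
  (tf : TemperedFrobenioid T₀ (ConnectedPart (BTemp X.Pi)) VD) (hZ : tf.monoidType = MonoidType.Z)
  (hP : ∀ A : (ConnectedPart (BTemp X.Pi))ᵒᵖ, IsPerfect (tf.Φ.carrier A))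
  (haug : IsOpenMap X.aug)
  (act : ∀ A : tf.category, MulDistribMulAction (Aut (TemperedFrobenioid.AE X tf haug A)) ↥(tf.units A))
  (hact : ∀ (A : tf.category) (α : Aut A) (u : ↥(tf.units A)), (TemperedFrobenioid.resE X tf haug A α) • u =
    (⟨α * u.1 * α⁻¹, (tf.units_normal A).conj_mem _ u.2 α⟩ : ↥(tf.units A)))
  (NHf : Subgroup (Field.absoluteGaloisGroup K) → tf.category → ℕ+ → Prop)
  (A₀ : tf.category) (hA₀ : PreFrobenioid.IsFrobeniusTrivial tf.toElem A₀) (hA₀' : SemiGraphs.IsGaloisObj A₀.base.obj)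
  (hHn : (mkOfConnectedTemperoid X tf hZ hP NHf A₀ hA₀ hA₀').HodotBsFld.Normal)
  (hHo : IsOpen ((mkOfConnectedTemperoid X tf hZ hP NHf A₀ hA₀ hA₀').HodotBsFld : Set (Field.absoluteGaloisGroup K)))

/-- **`hroot` AT A DOMAIN `A` ⟸ [FrdII] Rmk. 2.2.1 BY NAME** — `invariantUnitRoots_of_def22Ctx` (p466882) with the guard
`A″ ⟶ A_⊙^bs` replaced by `A″ ⟶ A^bs`; the argument is object-local in `A″`. [cite: MochizukiFrdII2008, Rmk 2.2.1 p.18] -/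
theorem Prop42Sub.invariantUnitRootsAt_of_def22Ctx (A : tf.category)
    (hNHf : ∀ (H : Subgroup (Field.absoluteGaloisGroup K)) (A : tf.category) (N : ℕ+), NHf H A N →
      ∃ (hn : H.Normal) (ho : IsOpen (H : Set (Field.absoluteGaloisGroup K))),
        PadicKummer.IsNHSaturated (TemperedFrobenioid.def22Ctx X tf haug A (act A) (hact A) H hn ho) N)
    (h221 : ∀ (A'' : tf.category) (N : ℕ+), (A''.base ⟶ A.base) → PreFrobenioid.IsFrobeniusTrivial tf.toElem A'' →
      PadicKummer.SaturatedInvariantsAdmitRoots (TemperedFrobenioid.def22Ctx X tf haug A'' (act A'') (hact A'')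
        (mkOfConnectedTemperoid X tf hZ hP NHf A₀ hA₀ hA₀').HodotBsFld hHn hHo) N) :
    ∀ (A'' : tf.category) (N : ℕ+), (A''.base ⟶ A.base) → PreFrobenioid.IsFrobeniusTrivial tf.toElem A'' →
      NHf (mkOfConnectedTemperoid X tf hZ hP NHf A₀ hA₀ hA₀').HodotBsFld A'' N →
      ∀ u : Aut A'', u ∈ tf.units A'' →
        (∀ (hA'' : SemiGraphs.IsGaloisObj A''.base.obj) (g : X.Pi),
          g ∈ (mkOfConnectedTemperoid X tf hZ hP NHf A₀ hA₀ hA₀').Hodot →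
          ∀ α : Aut A'', ModelFrobenioid.baseMap α.hom =
            ((mkOfConnectedTemperoid X tf hZ hP NHf A₀ hA₀ hA₀').galoisSurj A''.base hA'' g).hom → α * u * α⁻¹ = u) →
        ∃ r : Aut A'', r ∈ tf.units A'' ∧ r ^ (N : ℕ) = u := by
  intro A'' N b hft hsat u hu hinv
  obtain ⟨hn, ho, hsat'⟩ := hNHf _ A'' N hsat
  have hA'' : SemiGraphs.IsGaloisObj A''.base.obj := hsat'.galois
  have hfix : ∀ h : (TemperedFrobenioid.def22Ctx X tf haug A'' (act A'') (hact A'')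
      (mkOfConnectedTemperoid X tf hZ hP NHf A₀ hA₀ hA₀').HodotBsFld hHn hHo).HA,
      (h : (TemperedFrobenioid.def22Ctx X tf haug A'' (act A'') (hact A'')
        (mkOfConnectedTemperoid X tf hZ hP NHf A₀ hA₀ hA₀').HodotBsFld hHn hHo).AutE) •
        (show (TemperedFrobenioid.def22Ctx X tf haug A'' (act A'') (hact A'')
          (mkOfConnectedTemperoid X tf hZ hP NHf A₀ hA₀ hA₀').HodotBsFld hHn hHo).O from ⟨u, hu⟩) = ⟨u, hu⟩ := by
    intro h
    obtain ⟨x, hx, hxh⟩ := Subgroup.mem_map.mp h.2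
    obtain ⟨g', hg', rfl⟩ := Subgroup.mem_map.mp hx
    obtain ⟨α, hα⟩ := tf.exists_aut_mapAut_eq_of_isFrobeniusTrivial A'' hft
      ((mkOfConnectedTemperoid X tf hZ hP NHf A₀ hA₀ hA₀').galoisSurj A''.base hA'' g')
    have hres : TemperedFrobenioid.resE X tf haug A'' α = h.1 := by
      rw [← hxh]
      change (TemperedFrobenioid.augPush X haug).mapAut A''.base (tf.baseFunctorOfCategory.mapAut A'' α) =
        TemperedFrobenioid.outerRep X tf haug A'' (X.aug g')
      rw [hα, TemperedFrobenioid.outerRep_aug X tf haug A'' hA'' g']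
      rfl
    have hbase : ModelFrobenioid.baseMap α.hom =
        ((mkOfConnectedTemperoid X tf hZ hP NHf A₀ hA₀ hA₀').galoisSurj A''.base hA'' g').hom := by
      rw [← hα]; rfl
    rw [← hres]
    change (TemperedFrobenioid.resE X tf haug A'' α) • (⟨u, hu⟩ : ↥(tf.units A'')) = (⟨u, hu⟩ : ↥(tf.units A''))
    rw [hact]
    exact Subtype.ext (hinv hA'' g' hg' α hbase)
  obtain ⟨g, hg⟩ := h221 A'' N b hft hsat' ⟨u, hu⟩ hfix
  refine ⟨g.1, g.2, ?_⟩
  have hg' := congrArg Subtype.val hg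
  have hpow : (g ^ (N : ℕ)).val = g.val ^ (N : ℕ) := Subgroup.coe_pow _ _ _
  rw [hpow] at hg'
  exact hg'

end Faithful

section FaithfulSlot

variable {K : Type} [Field K] (X : SemiGraphs.TemperedArithmeticGroup.{0} K) {D₀ : Type} [Category.{0} D₀]
  {V : FrdIMonoidStub.{0}} {T₀ : RealifiedDivisorMonoids (D₀ := D₀) V}
  {VD : FrdICatStub.{1, 0, 0} (ConnectedPart (BTemp X.Pi))}
  (tf : TemperedFrobenioid T₀ (ConnectedPart (BTemp X.Pi)) VD) (hZ : tf.monoidType = MonoidType.Z)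
  (hP : ∀ A : (ConnectedPart (BTemp X.Pi))ᵒᵖ, IsPerfect (tf.Φ.carrier A))
  (haug : IsOpenMap X.aug)
  (act : ∀ A : tf.category, MulDistribMulAction (Aut (TemperedFrobenioid.AE X tf haug A)) ↥(tf.units A))
  (hact : ∀ (A : tf.category) (α : Aut A) (u : ↥(tf.units A)), (TemperedFrobenioid.resE X tf haug A α) • u =
    (⟨α * u.1 * α⁻¹, (tf.units_normal A).conj_mem _ u.2 α⟩ : ↥(tf.units A)))
  (A₀ : tf.category) (hA₀ : PreFrobenioid.IsFrobeniusTrivial tf.toElem A₀) (hA₀' : SemiGraphs.IsGaloisObj A₀.base.obj)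

/-- **The roots-of-constants law `hL_A` AT A DOMAIN `A` WITH `H_A^bs = {1}`, at the FAITHFUL [FrdII] Def. 2.2 (ii) slot**
(NH := «`def22Ctx A` is `(N, H)`-saturated»; the shape of the binder `hL_A` of `Prop42Sub.unitRootsUpstairsAt_of_constantRootsAt`
and of abc-iut-f-123's `hsurj_of_constantRootsAt_family` at `A := A_1`): ⟸ {`Φ` divisorial} ∪ {B2 data `haug`/`act`/`hact`} ∪
{[FrdII] Rmk. 2.2.1 at the instance BY NAME: `h221` for the Frobenius-trivial `A″` over `A`} ∪ {`htriv`: `H_⊙` acts trivially on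
`A^bs`}. [cite: MochizukiEtTh2009, Prop 4.2 p.90] -/
theorem Prop42Sub.constantRootsAt_mkOfConnectedTemperoid_faithful
    (hΦd : Objectwise (fun M _ => IsDivisorial M) tf.divisorMonoid)
    (A : tf.category) (hA : SemiGraphs.IsGaloisObj A.base.obj)
    (htriv : ∀ g ∈ (mkOfConnectedTemperoid X tf hZ hP (fun _ _ _ => True) A₀ hA₀ hA₀').Hodot,
      (mkOfConnectedTemperoid X tf hZ hP (fun _ _ _ => True) A₀ hA₀ hA₀').galoisSurj A.base hA g = 1)
    (h221 : ∀ (A'' : tf.category) (N : ℕ+), (A''.base ⟶ A.base) → PreFrobenioid.IsFrobeniusTrivial tf.toElem A'' →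
      PadicKummer.SaturatedInvariantsAdmitRoots (TemperedFrobenioid.def22Ctx X tf haug A'' (act A'') (hact A'')
          (mkOfConnectedTemperoid X tf hZ hP (fun H A N => ∃ (hn : H.Normal)
              (ho : IsOpen (H : Set (Field.absoluteGaloisGroup K))),
              PadicKummer.IsNHSaturated (TemperedFrobenioid.def22Ctx X tf haug A (act A) (hact A) H hn ho) N)
            A₀ hA₀ hA₀').HodotBsFld
          (mkOfConnectedTemperoid X tf hZ hP (fun _ _ _ => True) A₀ hA₀ hA₀').hodotBsFld_normal
          ((mkOfConnectedTemperoid X tf hZ hP (fun _ _ _ => True) A₀ hA₀ hA₀').isOpen_hodotBsFld_of_isOpenMap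
            (isOpen_Hodot_mkOfConnectedTemperoid X tf hZ hP _ A₀ hA₀ hA₀') haug)) N) :
    ∀ (A'' : tf.category) (N : ℕ+) (g : A''.base ⟶ A.base) (ξ : tf.ratFnFunctor.obj (op A.base)),
      PreFrobenioid.IsFrobeniusTrivial tf.toElem A'' →
      (mkOfConnectedTemperoid X tf hZ hP (fun H A N => ∃ (hn : H.Normal)
            (ho : IsOpen (H : Set (Field.absoluteGaloisGroup K))),
            PadicKummer.IsNHSaturated (TemperedFrobenioid.def22Ctx X tf haug A (act A) (hact A) H hn ho) N)
          A₀ hA₀ hA₀').IsNHSaturatedBsFld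
        (mkOfConnectedTemperoid X tf hZ hP (fun H A N => ∃ (hn : H.Normal)
            (ho : IsOpen (H : Set (Field.absoluteGaloisGroup K))),
            PadicKummer.IsNHSaturated (TemperedFrobenioid.def22Ctx X tf haug A (act A) (hact A) H hn ho) N)
          A₀ hA₀ hA₀').HodotBsFld A'' N →
      divB tf.divisorMonoid tf.ratFnFunctor tf.divBNatTrans (op A.base) ξ = 1 →
        ∃ ζ : tf.ratFnFunctor.obj (op A''.base), ζ ^ (N : ℕ) = pull tf.ratFnFunctor g ξ :=
  Prop42Sub.constantRootsAt_mkOfConnectedTemperoid_of_invariantUnitRoots X tf hZ hP _ A₀ hA₀ hA₀' hΦd A hA htriv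
    (Prop42Sub.invariantUnitRootsAt_of_def22Ctx X tf hZ hP haug act hact _ A₀ hA₀ hA₀' _ _ A
      (fun _ _ _ h => h) h221)

end FaithfulSlot

end BiKummerSetting

end Literature.AnabelianGeometry.EtaleTheta

end
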